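import Summits.PneNP.PneNP.Theorems.SfmBlMachineHat

/-!
# Line «sfm-bl», MACHINE LAYER M4-SEM (part 2): the machine's sub-pairs ARE the pipeline's families `𝒲 s` (stmt-PneNP-20523)

FRONTIER F-N1c; nothing here bears on P vs NP.

Generic dictionary setting (instantiated by the M5 dictionary with `E := {e // p e = some s}`, `φ := plegOf ∘ val`,
`ι₁ ι₂ := Subtype.val`): a finite leg type `E` with pieces `srcE : E → α`, `dstE : E → β`, an injective record map
`φ : E → PLeg` onto a duplicate-free leg list `xs`, and injective label maps `ι₁ : α → Lab` (tag `0`),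
`ι₂ : β → Lab` (tag `1`) with `labL (φ e) = ι₁ (srcE e)`, `labR (φ e) = ι₂ (dstE e)`.
For a sublist `w₁` of `lpieces xs` put `toW₁ w₁ := {a ∈ image srcE : ι₁ a ∈ w₁}` (and `toW₂`).  Proved:
* `filter_mem_eq_of_sublist` (a sublist of a duplicate-free list is recovered by filtering), the inverse pair
  `ofW_toW` / `toW_ofW`, `card_toW₁ / card_toW₂` (`= |w|`);
* `length_legsIn_filter_eq_card` — counts of inside legs are the pipeline's `#{e : …}` (so `cOut_legsIn_eq_card`,
  `meetCount_eq_card`, `length_legsIn_eq_card`).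
The connectivity test is identified in `SfmBlMachineHatConn` (`connTest_iff`); the sum identity
`hatSum = Σ_s Σ_{W ∈ 𝒲 s} meet · #bad completions` is assembled in `SfmBlMachineHatSum`.
-/

set_option linter.dupNamespace false -- `Summit.PneNP.PneNP.…`: summit = sub-problem name (D-0017 single-conjunct layout)

namespace Summit.PneNP.PneNP.Theorems.SfmBlMachine

open Finset

/-! ## Sublists of duplicate-free lists -/

/-- A sublist of a duplicate-free list is recovered by filtering on membership. -/
theorem filter_mem_eq_of_sublist {w l : List Lab} (hl : l.Nodup) (hw : List.Sublist w l) :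
    l.filter (fun P => decide (P ∈ w)) = w := by
  induction hw with
  | slnil => rfl
  | cons a h ih =>
    rename_i w l
    have ha : a ∉ w := fun hmem => (List.nodup_cons.1 hl).1 (h.subset hmem)
    rw [List.filter_cons_of_neg (by simpa using ha)]
    exact ih (List.nodup_cons.1 hl).2
  | cons_cons a h ih =>
    rename_i w l
    have hal : a ∉ l := (List.nodup_cons.1 hl).1
    rw [List.filter_cons_of_pos (by simp)]
    congr 1
    refine Eq.trans (List.filter_congr fun x hx => ?_) (ih (List.nodup_cons.1 hl).2)
    have : x ≠ a := fun h => hal (h ▸ hx)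
    simp [this]

section Dict

variable {α β E : Type} [Fintype E] [DecidableEq α] [DecidableEq β]
  (ι₁ : α → Lab) (ι₂ : β → Lab) (srcE : E → α) (dstE : E → β) (φ : E → PLeg) (xs : List PLeg)

/-- Left sub-pair side as a finset of pieces. -/
def toW₁ (w₁ : List Lab) : Finset α := (univ.image srcE).filter fun a => ι₁ a ∈ w₁

/-- Right sub-pair side as a finset of pieces. -/
def toW₂ (w₂ : List Lab) : Finset β := (univ.image dstE).filter fun b => ι₂ b ∈ w₂

/-- The inverse: the labels of a finset of left pieces, in the order of `lpieces xs`. -/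
def ofW₁ (W₁ : Finset α) : List Lab := (lpieces xs).filter fun P => decide (P ∈ W₁.image ι₁)

/-- The inverse on the right. -/
def ofW₂ (W₂ : Finset β) : List Lab := (rpieces xs).filter fun P => decide (P ∈ W₂.image ι₂)

variable {ι₁ ι₂ srcE dstE φ xs}

omit [Fintype E] [DecidableEq α] [DecidableEq β] in
/-- The left pieces of the spot's legs are the `ι₁`-labels of the sources. -/
theorem mem_lpieces_iff (hmem : ∀ x, x ∈ xs ↔ ∃ e, φ e = x) (hL : ∀ e, labL (φ e) = ι₁ (srcE e)) (P : Lab) :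
    P ∈ lpieces xs ↔ ∃ e, ι₁ (srcE e) = P := by
  unfold lpieces
  rw [List.mem_dedup, List.mem_map]
  constructor
  · rintro ⟨x, hx, rfl⟩; obtain ⟨e, rfl⟩ := (hmem x).1 hx; exact ⟨e, (hL e).symm⟩
  · rintro ⟨e, rfl⟩; exact ⟨φ e, (hmem _).2 ⟨e, rfl⟩, hL e⟩

omit [Fintype E] [DecidableEq α] [DecidableEq β] in
/-- The right pieces of the spot's legs are the `ι₂`-labels of the targets. -/
theorem mem_rpieces_iff (hmem : ∀ x, x ∈ xs ↔ ∃ e, φ e = x) (hR : ∀ e, labR (φ e) = ι₂ (dstE e)) (P : Lab) :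
    P ∈ rpieces xs ↔ ∃ e, ι₂ (dstE e) = P := by
  unfold rpieces
  rw [List.mem_dedup, List.mem_map]
  constructor
  · rintro ⟨x, hx, rfl⟩; obtain ⟨e, rfl⟩ := (hmem x).1 hx; exact ⟨e, (hR e).symm⟩
  · rintro ⟨e, rfl⟩; exact ⟨φ e, (hmem _).2 ⟨e, rfl⟩, hR e⟩

/-- `ofW₁ (toW₁ w₁) = w₁` for a sublist `w₁` of the left pieces. -/
theorem ofW₁_toW₁ (hmem : ∀ x, x ∈ xs ↔ ∃ e, φ e = x) (hL : ∀ e, labL (φ e) = ι₁ (srcE e))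
    {w₁ : List Lab} (hw : List.Sublist w₁ (lpieces xs)) :
    ofW₁ ι₁ xs (toW₁ ι₁ srcE w₁) = w₁ := by
  unfold ofW₁
  refine Eq.trans (List.filter_congr fun P hP => ?_) (filter_mem_eq_of_sublist (List.nodup_dedup _) hw)
  simp only [decide_eq_decide, toW₁, mem_image, mem_filter, mem_univ, true_and]
  constructor
  · rintro ⟨a, ⟨_, ha⟩, rfl⟩; exact ha
  · intro hPw
    obtain ⟨e, rfl⟩ := (mem_lpieces_iff hmem hL P).1 hP
    exact ⟨srcE e, ⟨⟨e, rfl⟩, hPw⟩, rfl⟩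

/-- `ofW₂ (toW₂ w₂) = w₂`. -/
theorem ofW₂_toW₂ (hmem : ∀ x, x ∈ xs ↔ ∃ e, φ e = x) (hR : ∀ e, labR (φ e) = ι₂ (dstE e))
    {w₂ : List Lab} (hw : List.Sublist w₂ (rpieces xs)) :
    ofW₂ ι₂ xs (toW₂ ι₂ dstE w₂) = w₂ := by
  unfold ofW₂
  refine Eq.trans (List.filter_congr fun P hP => ?_) (filter_mem_eq_of_sublist (List.nodup_dedup _) hw)
  simp only [decide_eq_decide, toW₂, mem_image, mem_filter, mem_univ, true_and]
  constructor
  · rintro ⟨b, ⟨_, hb⟩, rfl⟩; exact hb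
  · intro hPw
    obtain ⟨e, rfl⟩ := (mem_rpieces_iff hmem hR P).1 hP
    exact ⟨dstE e, ⟨⟨e, rfl⟩, hPw⟩, rfl⟩

/-- `toW₁ (ofW₁ W₁) = W₁` for `W₁ ⊆ image srcE`. -/
theorem toW₁_ofW₁ (hmem : ∀ x, x ∈ xs ↔ ∃ e, φ e = x) (hL : ∀ e, labL (φ e) = ι₁ (srcE e))
    (hι₁ : Function.Injective ι₁) {W₁ : Finset α} (hW : W₁ ⊆ univ.image srcE) :
    toW₁ ι₁ srcE (ofW₁ ι₁ xs W₁) = W₁ := by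
  ext a
  simp only [toW₁, ofW₁, mem_filter, List.mem_filter, decide_eq_true_eq, mem_image, mem_univ, true_and]
  constructor
  · rintro ⟨_, _, a', ha', h⟩; rwa [← hι₁ h]
  · intro ha
    obtain ⟨e, _, he⟩ := mem_image.1 (hW ha)
    exact ⟨⟨e, he⟩, (mem_lpieces_iff hmem hL _).2 ⟨e, by rw [he]⟩, a, ha, rfl⟩

/-- `toW₂ (ofW₂ W₂) = W₂`. -/
theorem toW₂_ofW₂ (hmem : ∀ x, x ∈ xs ↔ ∃ e, φ e = x) (hR : ∀ e, labR (φ e) = ι₂ (dstE e))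
    (hι₂ : Function.Injective ι₂) {W₂ : Finset β} (hW : W₂ ⊆ univ.image dstE) :
    toW₂ ι₂ dstE (ofW₂ ι₂ xs W₂) = W₂ := by
  ext b
  simp only [toW₂, ofW₂, mem_filter, List.mem_filter, decide_eq_true_eq, mem_image, mem_univ, true_and]
  constructor
  · rintro ⟨_, _, b', hb', h⟩; rwa [← hι₂ h]
  · intro hb
    obtain ⟨e, _, he⟩ := mem_image.1 (hW hb)
    exact ⟨⟨e, he⟩, (mem_rpieces_iff hmem hR _).2 ⟨e, by rw [he]⟩, b, hb, rfl⟩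

/-- The labels of `toW₁ w₁` are `w₁`. -/
theorem image_toW₁ (hmem : ∀ x, x ∈ xs ↔ ∃ e, φ e = x) (hL : ∀ e, labL (φ e) = ι₁ (srcE e))
    {w₁ : List Lab} (hw : List.Sublist w₁ (lpieces xs)) : (toW₁ ι₁ srcE w₁).image ι₁ = w₁.toFinset := by
  ext P
  simp only [toW₁, mem_image, mem_filter, mem_univ, true_and, List.mem_toFinset]
  constructor
  · rintro ⟨a, ⟨_, ha⟩, rfl⟩; exact ha
  · intro hP
    obtain ⟨e, rfl⟩ := (mem_lpieces_iff hmem hL P).1 (hw.subset hP)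
    exact ⟨srcE e, ⟨⟨e, rfl⟩, hP⟩, rfl⟩

/-- The labels of `toW₂ w₂` are `w₂`. -/
theorem image_toW₂ (hmem : ∀ x, x ∈ xs ↔ ∃ e, φ e = x) (hR : ∀ e, labR (φ e) = ι₂ (dstE e))
    {w₂ : List Lab} (hw : List.Sublist w₂ (rpieces xs)) : (toW₂ ι₂ dstE w₂).image ι₂ = w₂.toFinset := by
  ext P
  simp only [toW₂, mem_image, mem_filter, mem_univ, true_and, List.mem_toFinset]
  constructor
  · rintro ⟨b, ⟨_, hb⟩, rfl⟩; exact hb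
  · intro hP
    obtain ⟨e, rfl⟩ := (mem_rpieces_iff hmem hR P).1 (hw.subset hP)
    exact ⟨dstE e, ⟨⟨e, rfl⟩, hP⟩, rfl⟩

/-- `|toW₁ w₁| = |w₁|`. -/
theorem card_toW₁ (hmem : ∀ x, x ∈ xs ↔ ∃ e, φ e = x) (hL : ∀ e, labL (φ e) = ι₁ (srcE e))
    (hι₁ : Function.Injective ι₁) {w₁ : List Lab} (hw : List.Sublist w₁ (lpieces xs)) :
    (toW₁ ι₁ srcE w₁).card = w₁.length := by
  rw [← card_image_of_injective _ hι₁, image_toW₁ hmem hL hw,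
    List.toFinset_card_of_nodup (hw.nodup (List.nodup_dedup _))]

/-- `|toW₂ w₂| = |w₂|`. -/
theorem card_toW₂ (hmem : ∀ x, x ∈ xs ↔ ∃ e, φ e = x) (hR : ∀ e, labR (φ e) = ι₂ (dstE e))
    (hι₂ : Function.Injective ι₂) {w₂ : List Lab} (hw : List.Sublist w₂ (rpieces xs)) :
    (toW₂ ι₂ dstE w₂).card = w₂.length := by
  rw [← card_image_of_injective _ hι₂, image_toW₂ hmem hR hw,
    List.toFinset_card_of_nodup (hw.nodup (List.nodup_dedup _))]

/-! ## Inside legs ↔ legs with both ends in the pair -/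

/-- Membership in the inside legs. -/
theorem mem_legsIn_iff (hmem : ∀ x, x ∈ xs ↔ ∃ e, φ e = x) (hL : ∀ e, labL (φ e) = ι₁ (srcE e))
    (hR : ∀ e, labR (φ e) = ι₂ (dstE e)) (W : Cand) (x : PLeg) :
    x ∈ legsIn xs W ↔ ∃ e, (srcE e ∈ toW₁ ι₁ srcE W.1 ∧ dstE e ∈ toW₂ ι₂ dstE W.2) ∧ φ e = x := by
  unfold legsIn
  rw [List.mem_filter, hmem]
  simp only [Bool.and_eq_true, decide_eq_true_eq, toW₁, toW₂, mem_filter, mem_image, mem_univ, true_and]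
  constructor
  · rintro ⟨⟨e, rfl⟩, h1, h2⟩
    exact ⟨e, ⟨⟨⟨e, rfl⟩, by rwa [← hL]⟩, ⟨⟨e, rfl⟩, by rwa [← hR]⟩⟩, rfl⟩
  · rintro ⟨e, ⟨⟨_, h1⟩, ⟨_, h2⟩⟩, rfl⟩
    exact ⟨⟨e, rfl⟩, by rwa [hL], by rwa [hR]⟩

/-- A duplicate-free list in bijection with `{e : Q e}` through `φ` has `#{e : Q e}` items. -/
theorem length_eq_card_of_mem_iff {φ : E → PLeg} (hφ : Function.Injective φ) {ys : List PLeg} (hys : ys.Nodup)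
    (Q : E → Prop) [DecidablePred Q] (h : ∀ y, y ∈ ys ↔ ∃ e, Q e ∧ φ e = y) :
    ys.length = (univ.filter Q).card := by
  classical
  rw [← List.toFinset_card_of_nodup hys]
  have : ys.toFinset = (univ.filter Q).image φ := by
    ext y
    rw [List.mem_toFinset, h, mem_image]
    simp only [mem_filter, mem_univ, true_and]
  rw [this, card_image_of_injective _ hφ]

/-- **Counts of inside legs with a property are the pipeline's cardinalities.** -/
theorem length_legsIn_filter_eq_card (hφ : Function.Injective φ) (hxs : xs.Nodup) (hmem : ∀ x, x ∈ xs ↔ ∃ e, φ e = x)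
    (hL : ∀ e, labL (φ e) = ι₁ (srcE e)) (hR : ∀ e, labR (φ e) = ι₂ (dstE e)) (W : Cand)
    (q : PLeg → Bool) (Q : E → Prop) [DecidablePred Q] (hq : ∀ e, q (φ e) = true ↔ Q e) :
    ((legsIn xs W).filter q).length
      = (univ.filter fun e => Q e ∧ srcE e ∈ toW₁ ι₁ srcE W.1 ∧ dstE e ∈ toW₂ ι₂ dstE W.2).card := by
  have hnd : (legsIn xs W).Nodup := hxs.filter _
  refine length_eq_card_of_mem_iff hφ (hnd.filter q) _ fun y => ?_
  rw [List.mem_filter, mem_legsIn_iff hmem hL hR]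
  constructor
  · rintro ⟨⟨e, he, rfl⟩, hqy⟩; exact ⟨e, ⟨(hq e).1 hqy, he⟩, rfl⟩
  · rintro ⟨e, ⟨hQ, he⟩, rfl⟩; exact ⟨⟨e, he, rfl⟩, (hq e).2 hQ⟩

/-- `cOut` of the inside legs. -/
theorem cOut_legsIn_eq_card (hφ : Function.Injective φ) (hxs : xs.Nodup) (hmem : ∀ x, x ∈ xs ↔ ∃ e, φ e = x)
    (hL : ∀ e, labL (φ e) = ι₁ (srcE e)) (hR : ∀ e, labR (φ e) = ι₂ (dstE e)) (W : Cand) (j : ℕ) :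
    cOut (legsIn xs W) j
      = (univ.filter fun e => (φ e).1 = j ∧ srcE e ∈ toW₁ ι₁ srcE W.1 ∧ dstE e ∈ toW₂ ι₂ dstE W.2).card := by
  unfold cOut
  exact length_legsIn_filter_eq_card hφ hxs hmem hL hR W _ _ (fun e => by rw [decide_eq_true_eq])

/-- `meetCount` of the pair. -/
theorem meetCount_eq_card (hφ : Function.Injective φ) (hxs : xs.Nodup) (hmem : ∀ x, x ∈ xs ↔ ∃ e, φ e = x)
    (hL : ∀ e, labL (φ e) = ι₁ (srcE e)) (hR : ∀ e, labR (φ e) = ι₂ (dstE e)) (W : Cand) :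
    meetCount xs W = (univ.filter fun e => srcE e ∈ toW₁ ι₁ srcE W.1 ∨ dstE e ∈ toW₂ ι₂ dstE W.2).card := by
  unfold meetCount
  refine length_eq_card_of_mem_iff hφ (hxs.filter _) _ fun y => ?_
  rw [List.mem_filter, hmem]
  simp only [Bool.or_eq_true, decide_eq_true_eq, toW₁, toW₂, mem_filter, mem_image, mem_univ, true_and]
  constructor
  · rintro ⟨⟨e, rfl⟩, h⟩
    refine ⟨e, ?_, rfl⟩
    rcases h with h | h
    · exact Or.inl ⟨⟨e, rfl⟩, by rwa [← hL]⟩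
    · exact Or.inr ⟨⟨e, rfl⟩, by rwa [← hR]⟩
  · rintro ⟨e, h, rfl⟩
    refine ⟨⟨e, rfl⟩, ?_⟩
    rcases h with ⟨_, h⟩ | ⟨_, h⟩
    · exact Or.inl (by rwa [hL])
    · exact Or.inr (by rwa [hR])

/-- The length of the inside legs. -/
theorem length_legsIn_eq_card (hφ : Function.Injective φ) (hxs : xs.Nodup) (hmem : ∀ x, x ∈ xs ↔ ∃ e, φ e = x)
    (hL : ∀ e, labL (φ e) = ι₁ (srcE e)) (hR : ∀ e, labR (φ e) = ι₂ (dstE e)) (W : Cand) :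
    (legsIn xs W).length = (univ.filter fun e => srcE e ∈ toW₁ ι₁ srcE W.1 ∧ dstE e ∈ toW₂ ι₂ dstE W.2).card := by
  have := length_legsIn_filter_eq_card hφ hxs hmem hL hR W (fun _ => true) (fun _ => True) (fun _ => by simp)
  rw [List.filter_true] at this
  rw [this]
  exact congrArg _ (filter_congr fun e _ => by simp)

end Dict

end Summit.PneNP.PneNP.Theorems.SfmBlMachine
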